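import Mathlib
import Literature.Analysis.PDE.SingleEntropy.LPath
import HarnessLib

/-!
# Potentials of curl-free fields on a square: commuting mollifiers and a Cauchy estimate

Topic `Literature/Analysis/PDE/SingleEntropy` — part of the formalization of
De Lellis–Otto–Westdickenberg, *Minimal entropy conditions for Burgers equation*, Quart. Appl.
Math. 62 (2004) 687–700, Thm 2.3 / Cor 2.5 (the named fact
`Literature.Analysis.PDE.deLellisOttoWestdickenberg_singleEntropy`).

* `fderiv_mollify_of_hasLineDerivAt`: `∂ᵥ(ρ̄ ⋆ P) = ρ̄ ⋆ W` when `P` has continuous line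
  derivative `W` in direction `v` near the point;
* `mollify_comm`: mollifiers commute (Fubini);
* `abs_sub_le_of_hasLineDerivAt`: anisotropic Lipschitz estimate on a square from bounded axial
  line derivatives;
* `abs_sub_le_of_mollify_comm`: two potentials whose fields have equal cross-mollifications are
  uniformly close — `ρ̄' ⋆ P - ρ̄ ⋆ P'` has zero gradient hence is constant, and each mollification
  is close to its function. This yields uniform convergence of the potentials of the mollified
  fields of an `L^∞` curl-free field without any compactness argument. [folklore]
-/

noncomputable section

open MeasureTheory Set Filter Metric ContinuousLinearMap
open scoped Topology Convolution NNReal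

namespace Literature.Analysis.PDE.SingleEntropy

variable (ρ : ContDiffBump (0 : ℝ × ℝ))

/-! ## Mollification of functions with line derivatives; commuting mollifiers -/

section PotentialEstimates

/-- Derivative formula for the mollification of a locally integrable function. [folklore] -/
theorem fderiv_mollify_apply_of_locallyIntegrable {g : ℝ × ℝ → ℝ}
    (hli : LocallyIntegrable g volume) (p v : ℝ × ℝ) :
    fderiv ℝ (ρ.normed volume ⋆[lsmul ℝ ℝ, volume] g) p v
      = ∫ z, fderiv ℝ (ρ.normed volume) (p - z) v * g z := by
  have H := (ρ.hasCompactSupport_normed (μ := volume)).hasFDerivAt_convolution_left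
    (lsmul ℝ ℝ) (ρ.contDiff_normed (n := 1)) hli p
  rw [H.fderiv, ← convolution_flip]
  have e : ((lsmul ℝ ℝ : ℝ →L[ℝ] ℝ →L[ℝ] ℝ).precompL (ℝ × ℝ)).flip
      = (lsmul ℝ ℝ : ℝ →L[ℝ] ℝ →L[ℝ] ℝ).flip.precompR (ℝ × ℝ) := by
    rw [ContinuousLinearMap.precompL, ContinuousLinearMap.flip_flip]
  rw [e, convolution_precompR_apply _ hli ((ρ.hasCompactSupport_normed (μ := volume)).fderiv ℝ)
    ((ρ.contDiff_normed (n := 1)).continuous_fderiv one_ne_zero), convolution_def]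
  simp only [flip_apply, lsmul_apply, smul_eq_mul]

/-- If a continuous `P` has line derivative `W` (continuous) in direction `v` on the ball
`closedBall z ρ.rOut`, then `∂ᵥ(ρ̄ ⋆ P)(z) = (ρ̄ ⋆ W)(z)` (integration by parts). [folklore] -/
theorem fderiv_mollify_of_hasLineDerivAt {P W : ℝ × ℝ → ℝ} (hP : Continuous P)
    (hW : Continuous W) {v z : ℝ × ℝ}
    (hline : ∀ y ∈ closedBall z ρ.rOut, HasLineDerivAt ℝ P (W y) y v) :
    fderiv ℝ (ρ.normed volume ⋆[lsmul ℝ ℝ, volume] P) z v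
      = (ρ.normed volume ⋆[lsmul ℝ ℝ, volume] W) z := by
  rw [fderiv_mollify_apply_of_locallyIntegrable ρ hP.locallyIntegrable, mollify_apply]
  have hg : ∀ y, HasLineDerivAt ℝ (fun y => ρ.normed volume (z - y))
      (-(fderiv ℝ (ρ.normed volume) (z - y) v)) y v := by
    intro y
    have := ((differentiable_reflect ρ z) y).hasFDerivAt.hasLineDerivAt v
    rwa [fderiv_reflect_apply] at this
  have hk : Continuous fun y => ρ.normed volume (z - y) := (contDiff_reflect ρ z).continuous
  have hkc := hasCompactSupport_reflect ρ z
  have key := integral_bilinear_hasLineDerivAt_right_eq_neg_left_of_integrable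
    (μ := volume) (B := ContinuousLinearMap.mul ℝ ℝ) (f := P) (f' := W)
    (g := fun y => ρ.normed volume (z - y))
    (g' := fun y => -(fderiv ℝ (ρ.normed volume) (z - y) v)) (v := v) ?_ ?_ ?_
    (fun y hy => hline y (tsupport_reflect_subset ρ z hy)) (fun y _ => hg y)
  · simp only [ContinuousLinearMap.mul_apply'] at key
    have e1 : ∫ y, P y * -(fderiv ℝ (ρ.normed volume) (z - y) v)
        = -∫ y, fderiv ℝ (ρ.normed volume) (z - y) v * P y := by
      rw [← integral_neg]; congr 1; funext y; ring
    rw [e1] at key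
    have e2 : ∫ y, W y * ρ.normed volume (z - y) = ∫ y, ρ.normed volume (z - y) * W y := by
      congr 1; funext y; ring
    linarith
  · simp only [ContinuousLinearMap.mul_apply']
    exact (hW.mul hk).integrable_of_hasCompactSupport
      (hkc.mono (fun x hx => by intro h0; exact hx (by simp [h0])))
  · simp only [ContinuousLinearMap.mul_apply']
    exact (hP.mul ((continuous_fderiv_reflect ρ z v).neg)).integrable_of_hasCompactSupport
      ((hasCompactSupport_fderiv_reflect ρ z v).neg.mono
        (fun x hx => by
          intro h0
          apply hx
          show P x * -(fderiv ℝ (ρ.normed volume) (z - x) v) = 0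
          have : -(fderiv ℝ (ρ.normed volume) (z - x) v) = 0 := h0
          rw [this, mul_zero]))
  · simp only [ContinuousLinearMap.mul_apply']
    exact (hP.mul hk).integrable_of_hasCompactSupport
      (hkc.mono (fun x hx => by intro h0; exact hx (by simp [h0])))

/-- **Mollifiers commute**: `ρ̄' ⋆ (ρ̄ ⋆ g) = ρ̄ ⋆ (ρ̄' ⋆ g)` pointwise, for bounded measurable `g`
(Fubini and translation invariance). [folklore] -/
theorem mollify_comm (ρ' : ContDiffBump (0 : ℝ × ℝ)) {g : ℝ × ℝ → ℝ} (hg : Measurable g) {M : ℝ}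
    (hgM : ∀ z, |g z| ≤ M) (z : ℝ × ℝ) :
    (ρ'.normed volume ⋆[lsmul ℝ ℝ, volume] (ρ.normed volume ⋆[lsmul ℝ ℝ, volume] g)) z
      = (ρ.normed volume ⋆[lsmul ℝ ℝ, volume] (ρ'.normed volume ⋆[lsmul ℝ ℝ, volume] g)) z := by
  -- both sides as double integrals
  rw [mollify_apply, convolution_def]
  simp only [lsmul_apply, smul_eq_mul]
  have inner1 : ∀ a, (ρ.normed volume ⋆[lsmul ℝ ℝ, volume] g) a
      = ∫ c, ρ.normed volume c * g (a - c) := fun a => by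
    rw [convolution_def]; simp only [lsmul_apply, smul_eq_mul]
  have inner2 : ∀ c, (ρ'.normed volume ⋆[lsmul ℝ ℝ, volume] g) (z - c)
      = ∫ a, ρ'.normed volume (z - a) * g (a - c) := by
    intro c
    rw [mollify_apply]
    have := integral_add_right_eq_self (μ := volume)
      (fun a => ρ'.normed volume (z - a) * g (a - c)) c
    rw [← this]
    congr 1; funext a
    congr 2
    · abel
    · simp
  simp_rw [inner1, inner2]
  -- ∫ a, ρ̄'(z-a) * ∫ c, ρ̄ c * g (a - c)  =  ∫ c, ρ̄ c * ∫ a, ρ̄'(z-a) * g (a - c)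
  have hF : Integrable (Function.uncurry fun a c => ρ'.normed volume (z - a) * (ρ.normed volume c
      * g (a - c))) (volume.prod volume) := by
    have hcont : Continuous fun q : (ℝ × ℝ) × (ℝ × ℝ) =>
        ρ'.normed volume (z - q.1) * ρ.normed volume q.2 := by
      exact ((contDiff_reflect ρ' z).continuous.comp continuous_fst).mul
        (ρ.continuous_normed.comp continuous_snd)
    have hsupp : HasCompactSupport fun q : (ℝ × ℝ) × (ℝ × ℝ) =>
        ρ'.normed volume (z - q.1) * ρ.normed volume q.2 := by
      apply HasCompactSupport.of_support_subset_isCompact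
        ((isCompact_closedBall z ρ'.rOut).prod (isCompact_closedBall (0 : ℝ × ℝ) ρ.rOut))
      intro q hq
      rw [Function.mem_support] at hq
      refine mem_prod.mpr ⟨?_, ?_⟩
      · by_contra h
        exact hq (by rw [reflect_eq_zero ρ' (fun h' => h (ball_subset_closedBall h')), zero_mul])
      · by_contra h
        have : q.2 ∉ Function.support (ρ.normed volume) := by
          rw [ρ.support_normed_eq]; exact fun h' => h (ball_subset_closedBall h')
        rw [Function.notMem_support] at this
        exact hq (by rw [this, mul_zero])
    have hint : Integrable (fun q : (ℝ × ℝ) × (ℝ × ℝ) =>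
        ρ'.normed volume (z - q.1) * ρ.normed volume q.2) (volume.prod volume) :=
      hcont.integrable_of_hasCompactSupport hsupp
    refine (hint.mul_const |M|).mono' ?_ (ae_of_all _ fun q => ?_)
    · exact ((((contDiff_reflect ρ' z).continuous.measurable.comp measurable_fst)).mul
        ((ρ.continuous_normed.measurable.comp measurable_snd).mul
          (hg.comp (measurable_fst.sub measurable_snd)))).aestronglyMeasurable
    · obtain ⟨a, c⟩ := q
      simp only [Function.uncurry_apply_pair]
      rw [Real.norm_eq_abs, abs_mul, abs_mul, abs_of_nonneg (ρ'.nonneg_normed _),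
        abs_of_nonneg (ρ.nonneg_normed _), ← mul_assoc]
      exact mul_le_mul_of_nonneg_left ((hgM _).trans (le_abs_self M))
        (mul_nonneg (ρ'.nonneg_normed _) (ρ.nonneg_normed _))
  have swap := integral_integral_swap hF
  have lhs : ∫ a, ρ'.normed volume (z - a) * ∫ c, ρ.normed volume c * g (a - c)
      = ∫ a, ∫ c, ρ'.normed volume (z - a) * (ρ.normed volume c * g (a - c)) := by
    congr 1; funext a; rw [← integral_const_mul]
  have rhs : ∫ c, ρ.normed volume c * ∫ a, ρ'.normed volume (z - a) * g (a - c)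
      = ∫ c, ∫ a, ρ'.normed volume (z - a) * (ρ.normed volume c * g (a - c)) := by
    congr 1; funext c; rw [← integral_const_mul]; congr 1; funext a; ring
  rw [lhs, rhs, swap]

end PotentialEstimates


section PotentialEstimates2

/-- From a line derivative in direction `(1,0)` to the derivative of the `t`-slice. [folklore] -/
theorem hasDerivAt_fst_of_hasLineDerivAt {P : ℝ × ℝ → ℝ} {W t x : ℝ}
    (h : HasLineDerivAt ℝ P W (t, x) (1, 0)) : HasDerivAt (fun s => P (s, x)) W t := by
  unfold HasLineDerivAt at h
  have h0 : HasDerivAt (fun s => P ((t, x) + s • ((1 : ℝ), (0 : ℝ)))) W (t - t) := by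
    rw [sub_self]; exact h
  have h1 := HasDerivAt.comp_sub_const t t h0
  have e : (fun s => P ((t, x) + (s - t) • ((1 : ℝ), (0 : ℝ)))) = fun s => P (s, x) := by
    funext s
    congr 1
    ext <;> simp
  rw [e] at h1
  exact h1

/-- From a line derivative in direction `(0,1)` to the derivative of the `x`-slice. [folklore] -/
theorem hasDerivAt_snd_of_hasLineDerivAt {P : ℝ × ℝ → ℝ} {W t x : ℝ}
    (h : HasLineDerivAt ℝ P W (t, x) (0, 1)) : HasDerivAt (fun y => P (t, y)) W x := by
  unfold HasLineDerivAt at h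
  have h0 : HasDerivAt (fun s => P ((t, x) + s • ((0 : ℝ), (1 : ℝ)))) W (x - x) := by
    rw [sub_self]; exact h
  have h1 := HasDerivAt.comp_sub_const x x h0
  have e : (fun s => P ((t, x) + (s - x) • ((0 : ℝ), (1 : ℝ)))) = fun y => P (t, y) := by
    funext s
    congr 1
    ext <;> simp
  rw [e] at h1
  exact h1

/-- **Anisotropic Lipschitz estimate on a square** from bounded line derivatives along the axes.
[folklore] -/
theorem abs_sub_le_of_hasLineDerivAt {P W₁ W₂ : ℝ × ℝ → ℝ} {p₀ : ℝ × ℝ} {R B₁ B₂ : ℝ}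
    (h1 : ∀ z ∈ ball p₀ R, HasLineDerivAt ℝ P (W₁ z) z (1, 0))
    (h2 : ∀ z ∈ ball p₀ R, HasLineDerivAt ℝ P (W₂ z) z (0, 1))
    (hB₁ : ∀ z ∈ ball p₀ R, |W₁ z| ≤ B₁) (hB₂ : ∀ z ∈ ball p₀ R, |W₂ z| ≤ B₂)
    {a b : ℝ × ℝ} (ha : a ∈ ball p₀ R) (hb : b ∈ ball p₀ R) :
    |P a - P b| ≤ B₁ * |a.1 - b.1| + B₂ * |a.2 - b.2| := by
  have ha' := mem_ball_prod_iff.mp ha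
  have hb' := mem_ball_prod_iff.mp hb
  -- points on the two legs stay in the square
  have hleg1 : ∀ t ∈ uIcc a.1 b.1, (t, a.2) ∈ ball p₀ R := by
    intro t ht
    rw [mem_ball_prod_iff]
    refine ⟨?_, ha'.2⟩
    rcases mem_uIcc.mp ht with ⟨h1, h2⟩ | ⟨h1, h2⟩
    · exact abs_sub_lt_iff.mpr ⟨by linarith [(abs_sub_lt_iff.mp hb'.1).1],
        by linarith [(abs_sub_lt_iff.mp ha'.1).2]⟩
    · exact abs_sub_lt_iff.mpr ⟨by linarith [(abs_sub_lt_iff.mp ha'.1).1],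
        by linarith [(abs_sub_lt_iff.mp hb'.1).2]⟩
  have hleg2 : ∀ y ∈ uIcc a.2 b.2, (b.1, y) ∈ ball p₀ R := by
    intro y hy
    rw [mem_ball_prod_iff]
    refine ⟨hb'.1, ?_⟩
    rcases mem_uIcc.mp hy with ⟨h1, h2⟩ | ⟨h1, h2⟩
    · exact abs_sub_lt_iff.mpr ⟨by linarith [(abs_sub_lt_iff.mp hb'.2).1],
        by linarith [(abs_sub_lt_iff.mp ha'.2).2]⟩
    · exact abs_sub_lt_iff.mpr ⟨by linarith [(abs_sub_lt_iff.mp ha'.2).1],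
        by linarith [(abs_sub_lt_iff.mp hb'.2).2]⟩
  -- leg 1: vary `t` at height `a.2`
  have e1 : ‖P (b.1, a.2) - P (a.1, a.2)‖ ≤ B₁ * ‖b.1 - a.1‖ :=
    Convex.norm_image_sub_le_of_norm_hasDerivWithin_le (f := fun t => P (t, a.2))
      (fun t ht => (hasDerivAt_fst_of_hasLineDerivAt (h1 _ (hleg1 t ht))).hasDerivWithinAt)
      (fun t ht => by rw [Real.norm_eq_abs]; exact hB₁ _ (hleg1 t ht))
      (convex_uIcc a.1 b.1) left_mem_uIcc right_mem_uIcc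
  -- leg 2: vary `x` at time `b.1`
  have e2 : ‖P (b.1, b.2) - P (b.1, a.2)‖ ≤ B₂ * ‖b.2 - a.2‖ :=
    Convex.norm_image_sub_le_of_norm_hasDerivWithin_le (f := fun y => P (b.1, y))
      (fun y hy => (hasDerivAt_snd_of_hasLineDerivAt (h2 _ (hleg2 y hy))).hasDerivWithinAt)
      (fun y hy => by rw [Real.norm_eq_abs]; exact hB₂ _ (hleg2 y hy))
      (convex_uIcc a.2 b.2) left_mem_uIcc right_mem_uIcc
  rw [Real.norm_eq_abs, Real.norm_eq_abs] at e1 e2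
  have ea : P a = P (a.1, a.2) := by rw [Prod.mk.eta]
  have eb : P b = P (b.1, b.2) := by rw [Prod.mk.eta]
  calc |P a - P b| = |(P (a.1, a.2) - P (b.1, a.2)) + (P (b.1, a.2) - P (b.1, b.2))| := by
        rw [ea, eb]; ring_nf
    _ ≤ |P (a.1, a.2) - P (b.1, a.2)| + |P (b.1, a.2) - P (b.1, b.2)| := abs_add_le _ _
    _ = |P (b.1, a.2) - P (a.1, a.2)| + |P (b.1, b.2) - P (b.1, a.2)| := by
        congr 1 <;> exact abs_sub_comm _ _
    _ ≤ B₁ * |b.1 - a.1| + B₂ * |b.2 - a.2| := add_le_add e1 e2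
    _ = B₁ * |a.1 - b.1| + B₂ * |a.2 - b.2| := by rw [abs_sub_comm, abs_sub_comm b.2]

/-- A continuous linear functional on `ℝ × ℝ` vanishing on `(1,0)` and `(0,1)` is zero. [folklore] -/
theorem clm_eq_zero_of_apply_basis {A : ℝ × ℝ →L[ℝ] ℝ} (h1 : A (1, 0) = 0) (h2 : A (0, 1) = 0) :
    A = 0 := by
  refine ContinuousLinearMap.ext fun v => ?_
  obtain ⟨a, b⟩ := v
  have : ((a, b) : ℝ × ℝ) = a • ((1 : ℝ), (0 : ℝ)) + b • ((0 : ℝ), (1 : ℝ)) := by ext <;> simp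
  rw [this, map_add, map_smul, map_smul, h1, h2]
  simp

/-- **Cauchy estimate for approximate potentials** (commuting-mollifier argument). Two continuous
functions `P, P'` vanishing at `p₀`, with continuous line derivatives `W, W'` along the axes on
the square `ball p₀ R` bounded by `B₁, B₂`, whose derivatives have equal cross-mollifications
`ρ̄' ⋆ Wᵢ = ρ̄ ⋆ W'ᵢ` on `ball p₀ (R/2)`, satisfy `|P - P'| ≤ 2 (B₁ + B₂)(r + r')` on
`ball p₀ (R/2)`: indeed `ρ̄' ⋆ P - ρ̄ ⋆ P'` has zero derivative there, hence is constant, while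
each mollification is `(B₁ + B₂)·radius`-close to its function. [folklore] -/
theorem abs_sub_le_of_mollify_comm (ρ' : ContDiffBump (0 : ℝ × ℝ)) {P P' W₁ W₂ W₁' W₂' : ℝ × ℝ → ℝ}
    (hP : Continuous P) (hP' : Continuous P') (hW₁ : Continuous W₁) (hW₂ : Continuous W₂)
    (hW₁' : Continuous W₁') (hW₂' : Continuous W₂') {p₀ : ℝ × ℝ} {R B₁ B₂ : ℝ}
    (hB₁0 : 0 ≤ B₁) (hB₂0 : 0 ≤ B₂)
    (h1 : ∀ z ∈ ball p₀ R, HasLineDerivAt ℝ P (W₁ z) z (1, 0))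
    (h2 : ∀ z ∈ ball p₀ R, HasLineDerivAt ℝ P (W₂ z) z (0, 1))
    (h1' : ∀ z ∈ ball p₀ R, HasLineDerivAt ℝ P' (W₁' z) z (1, 0))
    (h2' : ∀ z ∈ ball p₀ R, HasLineDerivAt ℝ P' (W₂' z) z (0, 1))
    (hB₁ : ∀ z, |W₁ z| ≤ B₁) (hB₂ : ∀ z, |W₂ z| ≤ B₂)
    (hB₁' : ∀ z, |W₁' z| ≤ B₁) (hB₂' : ∀ z, |W₂' z| ≤ B₂)
    (hr : ρ.rOut ≤ R / 4) (hr' : ρ'.rOut ≤ R / 4)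
    (hc1 : ∀ z ∈ ball p₀ (R / 2), (ρ'.normed volume ⋆[lsmul ℝ ℝ, volume] W₁) z
      = (ρ.normed volume ⋆[lsmul ℝ ℝ, volume] W₁') z)
    (hc2 : ∀ z ∈ ball p₀ (R / 2), (ρ'.normed volume ⋆[lsmul ℝ ℝ, volume] W₂) z
      = (ρ.normed volume ⋆[lsmul ℝ ℝ, volume] W₂') z)
    (h0 : P p₀ = 0) (h0' : P' p₀ = 0) {z : ℝ × ℝ} (hz : z ∈ ball p₀ (R / 2)) :
    |P z - P' z| ≤ 2 * (B₁ + B₂) * (ρ.rOut + ρ'.rOut) := by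
  have hRpos : 0 < R := by
    have := (mem_ball.mp hz)
    have h := dist_nonneg (x := z) (y := p₀)
    linarith
  -- small closed balls around points of the half-square stay in the square
  have hsub : ∀ {w : ℝ × ℝ} {r : ℝ}, w ∈ ball p₀ (R / 2) → r ≤ R / 4 →
      closedBall w r ⊆ ball p₀ R := by
    intro w r hw hr y hy
    rw [mem_ball] at hw ⊢
    rw [mem_closedBall] at hy
    calc dist y p₀ ≤ dist y w + dist w p₀ := dist_triangle _ _ _
      _ < R := by linarith
  have hsub' : ∀ {w : ℝ × ℝ} {r : ℝ}, w ∈ ball p₀ (R / 2) → r ≤ R / 4 → ball w r ⊆ ball p₀ R :=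
    fun hw hr => ball_subset_closedBall.trans (hsub hw hr)
  -- the difference of cross-mollifications
  set D : ℝ × ℝ → ℝ := fun w => (ρ'.normed volume ⋆[lsmul ℝ ℝ, volume] P) w
    - (ρ.normed volume ⋆[lsmul ℝ ℝ, volume] P') w with hD
  have hDd : Differentiable ℝ D := by
    have a := ((ρ'.hasCompactSupport_normed (μ := volume)).contDiff_convolution_left (lsmul ℝ ℝ)
      (ρ'.contDiff_normed (n := 1)) (hP.locallyIntegrable (μ := volume))).differentiable
      one_ne_zero
    have b := ((ρ.hasCompactSupport_normed (μ := volume)).contDiff_convolution_left (lsmul ℝ ℝ)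
      (ρ.contDiff_normed (n := 1)) (hP'.locallyIntegrable (μ := volume))).differentiable
      one_ne_zero
    exact a.sub b
  have hDf : ∀ w ∈ ball p₀ (R / 2), fderiv ℝ D w = 0 := by
    intro w hw
    have a := ((ρ'.hasCompactSupport_normed (μ := volume)).contDiff_convolution_left (lsmul ℝ ℝ)
      (ρ'.contDiff_normed (n := 1)) (hP.locallyIntegrable (μ := volume))).differentiable
      one_ne_zero w
    have b := ((ρ.hasCompactSupport_normed (μ := volume)).contDiff_convolution_left (lsmul ℝ ℝ)
      (ρ.contDiff_normed (n := 1)) (hP'.locallyIntegrable (μ := volume))).differentiable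
      one_ne_zero w
    have e : fderiv ℝ D w = fderiv ℝ (ρ'.normed volume ⋆[lsmul ℝ ℝ, volume] P) w
        - fderiv ℝ (ρ.normed volume ⋆[lsmul ℝ ℝ, volume] P') w := fderiv_sub a b
    rw [e]
    apply clm_eq_zero_of_apply_basis
    · rw [_root_.sub_apply, fderiv_mollify_of_hasLineDerivAt ρ' hP hW₁
        (fun y hy => h1 y (hsub hw hr' hy)),
        fderiv_mollify_of_hasLineDerivAt ρ hP' hW₁' (fun y hy => h1' y (hsub hw hr hy)),
        hc1 w hw, sub_self]
    · rw [_root_.sub_apply, fderiv_mollify_of_hasLineDerivAt ρ' hP hW₂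
        (fun y hy => h2 y (hsub hw hr' hy)),
        fderiv_mollify_of_hasLineDerivAt ρ hP' hW₂' (fun y hy => h2' y (hsub hw hr hy)),
        hc2 w hw, sub_self]
  have hp₀ : p₀ ∈ ball p₀ (R / 2) := mem_ball_self (by linarith)
  have hDconst : D z = D p₀ :=
    (convex_ball p₀ (R / 2)).is_const_of_fderivWithin_eq_zero hDd.differentiableOn
      (fun w hw => by rw [fderivWithin_of_isOpen isOpen_ball hw]; exact hDf w hw) hz hp₀
  -- each mollification is close to its function
  have hclose : ∀ (Q Wa Wb : ℝ × ℝ → ℝ) (β : ContDiffBump (0 : ℝ × ℝ)), Continuous Q →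
      (∀ y ∈ ball p₀ R, HasLineDerivAt ℝ Q (Wa y) y (1, 0)) →
      (∀ y ∈ ball p₀ R, HasLineDerivAt ℝ Q (Wb y) y (0, 1)) →
      (∀ y, |Wa y| ≤ B₁) → (∀ y, |Wb y| ≤ B₂) → β.rOut ≤ R / 4 →
      ∀ w ∈ ball p₀ (R / 2),
        |(β.normed volume ⋆[lsmul ℝ ℝ, volume] Q) w - Q w| ≤ (B₁ + B₂) * β.rOut := by
    intro Q Wa Wb β hQ ha hb hBa hBb hβ w hw
    have key := ContDiffBump.dist_normed_convolution_le (μ := volume) (φ := β)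
      hQ.aestronglyMeasurable (x₀ := w) (ε := (B₁ + B₂) * β.rOut) (fun y hy => by
        rw [Real.dist_eq]
        have hyR : y ∈ ball p₀ R := hsub' hw hβ hy
        have hwR : w ∈ ball p₀ R := hsub' hw hβ (mem_ball_self β.rOut_pos)
        have est := abs_sub_le_of_hasLineDerivAt ha hb (fun y _ => hBa y) (fun y _ => hBb y)
          hyR hwR
        have d1 : |y.1 - w.1| ≤ dist y w := by
          rw [Prod.dist_eq, Real.dist_eq]; exact le_max_left _ _
        have d2 : |y.2 - w.2| ≤ dist y w := by
          rw [Prod.dist_eq, Real.dist_eq, Real.dist_eq]; exact le_max_right _ _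
        have hd : dist y w ≤ β.rOut := (mem_ball.mp hy).le
        nlinarith [mul_le_mul_of_nonneg_left (d1.trans hd) hB₁0,
          mul_le_mul_of_nonneg_left (d2.trans hd) hB₂0])
    rwa [Real.dist_eq] at key
  have c1 := hclose P W₁ W₂ ρ' hP h1 h2 hB₁ hB₂ hr' z hz
  have c2 := hclose P' W₁' W₂' ρ hP' h1' h2' hB₁' hB₂' hr z hz
  have c3 := hclose P W₁ W₂ ρ' hP h1 h2 hB₁ hB₂ hr' p₀ hp₀
  have c4 := hclose P' W₁' W₂' ρ hP' h1' h2' hB₁' hB₂' hr p₀ hp₀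
  rw [h0, sub_zero] at c3
  rw [h0', sub_zero] at c4
  have eD : (ρ'.normed volume ⋆[lsmul ℝ ℝ, volume] P) z - (ρ.normed volume ⋆[lsmul ℝ ℝ, volume] P') z
      = (ρ'.normed volume ⋆[lsmul ℝ ℝ, volume] P) p₀
        - (ρ.normed volume ⋆[lsmul ℝ ℝ, volume] P') p₀ := hDconst
  -- combine
  have : |P z - P' z| ≤ |(ρ'.normed volume ⋆[lsmul ℝ ℝ, volume] P) z - P z|
      + |(ρ'.normed volume ⋆[lsmul ℝ ℝ, volume] P) p₀|
      + |(ρ.normed volume ⋆[lsmul ℝ ℝ, volume] P') p₀|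
      + |(ρ.normed volume ⋆[lsmul ℝ ℝ, volume] P') z - P' z| := by
    have e : P z - P' z = -((ρ'.normed volume ⋆[lsmul ℝ ℝ, volume] P) z - P z)
        + ((ρ'.normed volume ⋆[lsmul ℝ ℝ, volume] P) p₀)
        - ((ρ.normed volume ⋆[lsmul ℝ ℝ, volume] P') p₀)
        + ((ρ.normed volume ⋆[lsmul ℝ ℝ, volume] P') z - P' z) := by linarith
    rw [e]
    refine (abs_add_le _ _).trans (add_le_add ((abs_sub _ _).trans (add_le_add
      ((abs_add_le _ _).trans (add_le_add (by rw [abs_neg]) le_rfl)) le_rfl)) le_rfl)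
  nlinarith [c1, c2, c3, c4, this, ρ.rOut_pos, ρ'.rOut_pos]

end PotentialEstimates2

end Literature.Analysis.PDE.SingleEntropy
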